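import Summits.ABC.IUTFork.Cor312HullGluedDHVolGlobal
import Summits.ABC.IUTFork.Cor312StatementStability
import Summits.ABC.IUTFork.Cor312StatementBridges
import HarnessLib

/-!
# [IUTchIII] Cor. 3.12 — the hull-glued setting WITHOUT one-set stability: CONTAINERS at the exceptional
# packets and the EXCESS of `−|log(Θ)|♮` over `−|log(Θ)|` (the [IUTchIV] Thm. 1.10 Step (v) / Prop. 1.4 (iii) shape)

PROOF-ONLY sequel (abc-iut cell, seat abc-iut-w5-d082, WAVE-5; row «HULLGLUED-CONTAINER» named by abc-iut-w5-d121)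
of abc-iut-w5-d060's `Cor312HullGluedStable` (p424693) / `Cor312HullGluedDHVolGlobal` and abc-iut-c312-5's
`Cor312HullGluedDHVolSharpGlobal` (p430293). TAKES NO SIDE on [IUTchIII] Cor. 3.12; no definition, no `Prop` fact.

`P♮ := P.hullGlued` is the setting `P` with print's `^{n,∘}𝒰_{j,v_ℚ} = P.thetaHull j vQ` (kurims
`paper:url-4b091feeb646`, proof of Cor. 3.12 p. 174 l. 50 – p. 175 l. 1) as THE Θ-region at every packet. The tree
holds: `−|log(Θ)|(P) ≤ −|log(Θ)|(P♮)` and `P.Statement → P♮.Statement` from monotone volumes alone (w5-d060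
`hullGlued_statement_of_mono`), and EQUALITY of all invariants wherever `^{n,∘}𝒰` is (Ind1),(Ind2)-STABLE (`hst`,
p424693) — at the sharp setting of record a theorem at every packet not over `2·disc(F)` and a hypothesis `hbad`
at the finitely many others (p430293), expected false at odd tamely ramified packets (c312-5 finding on STATUS).
[IUTchIV] Thm. 1.10 does NOT use stability there: Step (v) (kurims pp. 27–29) bounds the hull at a general
`v_ℚ ∈ 𝕍^non` by a CONTAINER (Prop. 1.4 (iii): an upper bound with explicit `log(𝔡)`, `log(𝔰)` terms); only
Step (vi) has "container = ⊗ log-shells" exactly. THIS FILE types the container mechanism over any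
`Cor312.Setting` (abc-iut-c312-7):

* §1 at one packet, NO stability of `^{n,∘}𝒰`: if a set `W` mapped onto itself by every (Ind1)/(Ind2)-family
  contains `^{n,∘}𝒰_{j,v_ℚ}`, then ALL possible images of `P♮` lie in `W`
  (`hullGlued_sUnion_possibleImages_subset_of_stable`), `^{n,∘}𝒰♮ ⊆ H` for every hull-set `H ⊇ W`
  (`hullGlued_thetaHull_subset_of_stable`), and the local Θ-volume of `P♮` is AT MOST `μ^log(H)`
  (`hullGlued_thetaLocal_le_logvol_of_stable`; monotone volumes); with `^{n,∘}𝒰 ⊆ ^{n,∘}𝒰♮` (w5-d060) this is the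
  two-sided window `μ^log(^{n,∘}𝒰) ≤ μ^log(^{n,∘}𝒰♮) ≤ μ^log(H)` at a CONTAINER packet;
* §2 globally: `negLogTheta_le_hullGlued_negLogTheta` (`−|log(Θ)| ≤ −|log(Θ)|♮`, w5-d060's monotone step as a
  standalone inequality) and **`hullGlued_negLogTheta_le_add`**: if at every label packet
  `μ^log(^{n,∘}𝒰♮_{i+1,v_ℚ}) ≤ μ^log(^{n,∘}𝒰_{i+1,v_ℚ}) + ε_i(v_ℚ)` with `ε_i` finitely supported, then
  `−|log(Θ)|♮ ≤ −|log(Θ)| + E`, `E := processionNormalized (i ↦ Σ_{v_ℚ} ε_i(v_ℚ))` — so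
  **`hullGlued_negLogTheta_window`**: `−|log(Θ)| ≤ −|log(Θ)|♮ ≤ −|log(Θ)| + E`; and
  **`negLogQ_le_negLogTheta_add_of_hullGlued_statement`**: the typed Statement FOR `P♮` gives
  `−|log(q)| ≤ −|log(Θ)| + E` for `P` (the converse of w5-d060's transfer, up to the explicit excess `E`;
  `E = 0` recovers p424693's equivalence);
* §2b the excess from PACKET DATA: `ε_i(v_ℚ) := μ^log(H_{i,v_ℚ}) − μ^log(^{n,∘}𝒰_{i+1,v_ℚ})` on a finite
  exceptional set carrying containers `H_{i,v_ℚ}`, `0` where `hst` holds (`hullGlued_thetaLocal_le_add_of_cover`,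
  `hullGlued_negLogTheta_le_add_of_cover`).
The real instances (containers = scaled log-shell lattices `e⁻¹(Π_{v⃗} p^k·I_{v⃗})` of abc-iut-c312-5 inside explicit
hull-sets, at the packets over `2·disc(F)` of `Real.settingDHVolSharp`) are the companion
`Cor312HullGluedDHVolContainer`. Reading (neutral): without `hst` the hull-gluing bracket is an explicit finite
WINDOW, not an equality; nothing here constrains the Θ-glue or asserts either Statement.
[claim: Mochizuki2012, status: disputed] vocabulary only. [cite: Mochizuki2012, IUTchIV Thm 1.10 proof Step (v) pp. 27–29,
Prop. 1.4 (iii) p. 13] [cite: DupuyHilado2025, §4.7, §4.9, §4.10]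
-/

noncomputable section

open Set Function

/-! ## 1. One packet: containers instead of stability -/

namespace Summit.ABC.IUTFork.Cor312.Setting

open Thm311 Literature.IUT.LogThetaLattice

variable {T : ThetaIndex} {S : Situation T} (P : Setting S)

section AtPacket

variable {j : T.Label} {vQ : T.VQ} {W : Set (S.L.Packet j vQ)}
  (hW : ∀ Φ ∈ S.L.Ind1Family ∪ S.L.Ind2Family, Φ j vQ '' W = W) (hsub : P.thetaHull j vQ ⊆ W)

include hW hsub

/-- **All possible images of `P♮` inside a stable container**: if every (Ind1)/(Ind2)-family maps `W` onto itself
and `^{n,∘}𝒰_{j,v_ℚ} ⊆ W`, then `⋃₀ P♮.possibleImages j vQ ⊆ W` — the (Ind3)-region of `P♮` IS `^{n,∘}𝒰`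
(abc-iut-c312-7 `sUnion_possibleImages_subset`; Dupuy–Hilado §4.10). No stability of `^{n,∘}𝒰` itself is used.
[cite: DupuyHilado2025, §4.10] -/
theorem hullGlued_sUnion_possibleImages_subset_of_stable : ⋃₀ P.hullGlued.possibleImages j vQ ⊆ W :=
  P.hullGlued.sUnion_possibleImages_subset hW (by rw [hullGlued_thetaRegion3]; exact hsub)

/-- **`^{n,∘}𝒰♮ ⊆ H` for every hull-set `H` containing the stable container `W`** ("the smallest `λ·𝒪`
containing" the union of the possible images of `P♮`, [IUTchIII] Rmk. 3.9.5 (i)). [cite: DupuyHilado2025, §4.10] -/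
theorem hullGlued_thetaHull_subset_of_stable {H : Set (S.L.Packet j vQ)} (hH : H ∈ (P.frame j vQ).Hul)
    (hWH : W ⊆ H) : P.hullGlued.thetaHull j vQ ⊆ H :=
  (P.frame j vQ).hull_subset_of_mem hH ((P.hullGlued_sUnion_possibleImages_subset_of_stable hW hsub).trans hWH)

/-- The union of the possible images of `P♮` is then relatively compact (it lies in a hull-set). [folklore] -/
theorem hullGlued_isBounded_sUnion_of_stable {H : Set (S.L.Packet j vQ)} (hH : H ∈ (P.frame j vQ).Hul)
    (hWH : W ⊆ H) : (P.frame j vQ).IsBounded (⋃₀ P.hullGlued.possibleImages j vQ) :=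
  (P.frame j vQ).bounded_mono _ H ((P.hullGlued_sUnion_possibleImages_subset_of_stable hW hsub).trans hWH)
    ((P.frame j vQ).hul_bounded H hH)

/-- **`HullDefined♮` from a container**, when "admits a hull" is monotone along inclusions of bounded sets (at the
real frames it is non-degeneracy, `Setting.isNondegenerate_mono`) and `P.HullDefined` (the union of `P`'s possible
images, which admits a hull, lies in that of `P♮`'s: w5-d060 `sUnion_possibleImages_subset_hullGlued`). [folklore] -/
theorem hullGlued_hullDefined_of_stable {H : Set (S.L.Packet j vQ)} (hH : H ∈ (P.frame j vQ).Hul) (hWH : W ⊆ H)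
    (hmonoHas : ∀ U U' : Set (S.L.Packet j vQ), U ⊆ U' → (P.frame j vQ).IsBounded U' →
      (P.frame j vQ).HasHull U → (P.frame j vQ).HasHull U')
    (hdef : P.HullDefined j vQ) : P.hullGlued.HullDefined j vQ :=
  have hb := P.hullGlued_isBounded_sUnion_of_stable hW hsub hH hWH
  ⟨hb, hmonoHas _ _ (P.sUnion_possibleImages_subset_hullGlued j vQ) hb hdef.2⟩

end AtPacket

end Summit.ABC.IUTFork.Cor312.Setting

namespace Summit.ABC.IUTFork.Cor312Vol

open Thm311 Cor312 Cor312.Setting Literature.IUT.LogThetaLattice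

variable {T : ThetaIndex} {S : Situation T} {P : Cor312.Setting S}

/-- **The local Θ-volume of `P♮` is at most the log-volume of any hull-set containing `^{n,∘}𝒰♮`** (monotone
volumes; hull-sets are admissible, `hul_adm`). With w5-d060's `thetaLocal_le_hullGlued_thetaLocal` this is the
window `μ^log(^{n,∘}𝒰) ≤ μ^log(^{n,∘}𝒰♮) ≤ μ^log(H)` at a container packet — the [IUTchIV] Thm. 1.10 Step (v) shape.
[cite: Mochizuki2012, IUTchIV Thm 1.10 proof Step (v) pp. 27–29] -/
theorem hullGlued_thetaLocal_le_logvol (hmono : LogvolMono P) (i : Fin T.lstar) (vQ : T.VQ)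
    {H : Set (S.L.Packet (labelSucc i) vQ)} (hH : H ∈ (P.frame (labelSucc i) vQ).Hul)
    (hdef' : P.hullGlued.HullDefined (labelSucc i) vQ) (hsubH : P.hullGlued.thetaHull (labelSucc i) vQ ⊆ H) :
    P.hullGlued.thetaLocal (labelSucc i) vQ ≤ (((S.D P.n).logvol _ vQ H : ℝ) : WithTop ℝ) := by
  unfold Setting.thetaLocal
  rw [if_pos hdef']
  exact WithTop.coe_le_coe.2 (hmono i vQ (P.hullGlued.thetaHull_adm hdef') (P.hul_adm _ vQ H hH) hsubH)

/-- **The window at a CONTAINER packet**: for a set `W` mapped onto itself by every (Ind1)/(Ind2)-family with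
`^{n,∘}𝒰_{i+1,v_ℚ} ⊆ W ⊆ H`, `H` a hull-set, and both hulls defined,
`μ^log(^{n,∘}𝒰_{i+1,v_ℚ}) ≤ μ^log(^{n,∘}𝒰♮_{i+1,v_ℚ}) ≤ μ^log(H)` — NO stability of `^{n,∘}𝒰`.
[cite: Mochizuki2012, IUTchIV Thm 1.10 proof Step (v) pp. 27–29] [cite: DupuyHilado2025, §4.10] -/
theorem hullGlued_thetaLocal_window_of_stable (hmono : LogvolMono P) (i : Fin T.lstar) (vQ : T.VQ)
    {W H : Set (S.L.Packet (labelSucc i) vQ)}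
    (hW : ∀ Φ ∈ S.L.Ind1Family ∪ S.L.Ind2Family, Φ (labelSucc i) vQ '' W = W)
    (hsub : P.thetaHull (labelSucc i) vQ ⊆ W) (hH : H ∈ (P.frame (labelSucc i) vQ).Hul) (hWH : W ⊆ H)
    (hdef : P.HullDefined (labelSucc i) vQ) (hdef' : P.hullGlued.HullDefined (labelSucc i) vQ) :
    P.thetaLocal (labelSucc i) vQ ≤ P.hullGlued.thetaLocal (labelSucc i) vQ ∧
      P.hullGlued.thetaLocal (labelSucc i) vQ ≤ (((S.D P.n).logvol _ vQ H : ℝ) : WithTop ℝ) :=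
  ⟨thetaLocal_le_hullGlued_thetaLocal hmono i vQ hdef hdef',
    hullGlued_thetaLocal_le_logvol hmono i vQ hH hdef' (P.hullGlued_thetaHull_subset_of_stable hW hsub hH hWH)⟩

/-! ## 2. Globally: `−|log(Θ)| ≤ −|log(Θ)|♮ ≤ −|log(Θ)| + E` and the Statement of `P♮` read back on `P` -/

/-- **`−|log(Θ)| ≤ −|log(Θ)|♮`** (monotone volumes; both Θ-finite): w5-d060's step of `hullGlued_statement_of_mono`
as a standalone inequality. [claim: Mochizuki2012, status: disputed] -/
theorem negLogTheta_le_hullGlued_negLogTheta (hmono : LogvolMono P) (hfin : P.ThetaFinite)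
    (hfin' : P.hullGlued.ThetaFinite) : P.negLogTheta ≤ P.hullGlued.negLogTheta := by
  have hdef : ∀ (i : Fin T.lstar) (vQ : T.VQ), P.HullDefined (labelSucc i) vQ := fun i vQ => by
    by_contra hd
    exact hfin.1 i vQ (by unfold Setting.thetaLocal; rw [if_neg hd])
  have hdef' : ∀ (i : Fin T.lstar) (vQ : T.VQ), P.hullGlued.HullDefined (labelSucc i) vQ := fun i vQ => by
    by_contra hd
    exact hfin'.1 i vQ (by unfold Setting.thetaLocal; rw [if_neg hd])
  have hloc : ∀ (i : Fin T.lstar) (vQ : T.VQ),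
      (P.thetaLocal (labelSucc i) vQ).untopD 0 ≤ (P.hullGlued.thetaLocal (labelSucc i) vQ).untopD 0 := by
    intro i vQ
    have hle := hmono i vQ (P.thetaHull_adm (hdef i vQ)) (P.hullGlued.thetaHull_adm (hdef' i vQ))
      (P.thetaHull_subset_hullGlued_thetaHull _ vQ)
    unfold Setting.thetaLocal
    rw [if_pos (hdef i vQ), if_pos (hdef' i vQ), WithTop.untopD_coe, WithTop.untopD_coe]
    exact hle
  rw [P.negLogTheta_eq_of_thetaFinite hfin, P.hullGlued.negLogTheta_eq_of_thetaFinite hfin']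
  exact WithTop.coe_le_coe.2 (processionNormalized_mono fun i =>
    finsum_le_finsum' (hfin.2 i) (hfin'.2 i) fun vQ => hloc i vQ)

section Excess

variable (ε : Fin T.lstar → T.VQ → ℝ) (hεfin : ∀ i, (Function.support (ε i)).Finite)
  (hε : ∀ (i : Fin T.lstar) (vQ : T.VQ),
    (P.hullGlued.thetaLocal (labelSucc i) vQ).untopD 0 ≤ (P.thetaLocal (labelSucc i) vQ).untopD 0 + ε i vQ)

include hεfin hε

/-- **`−|log(Θ)|♮ ≤ −|log(Θ)| + E`, `E = processionNormalized (i ↦ Σ_{v_ℚ} ε_i(v_ℚ))`**: a packet-wise EXCESS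
`ε_i(v_ℚ)` of the local Θ-volume of `P♮` over that of `P` (finitely supported in `v_ℚ`) sums to a global excess —
the shape of [IUTchIV] Thm. 1.10 Step (v)/(viii), where the container terms at the finitely many exceptional
`v_ℚ` are carried as explicit summands. Both settings Θ-finite. [cite: Mochizuki2012, IUTchIV Thm 1.10 proof Step (v) pp. 27–29] -/
theorem hullGlued_negLogTheta_le_add (hfin : P.ThetaFinite) (hfin' : P.hullGlued.ThetaFinite) :
    P.hullGlued.negLogTheta ≤
      P.negLogTheta + ((processionNormalized fun i : Fin T.lstar => ∑ᶠ vQ : T.VQ, ε i vQ : ℝ) : WithTop ℝ) := by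
  have hadd : ∀ f g : Fin T.lstar → ℝ,
      processionNormalized f + processionNormalized g = processionNormalized fun i => f i + g i := fun f g => by
    unfold processionNormalized
    rw [Finset.sum_add_distrib, add_div]
  rw [P.negLogTheta_eq_of_thetaFinite hfin, P.hullGlued.negLogTheta_eq_of_thetaFinite hfin', ← WithTop.coe_add, hadd]
  refine WithTop.coe_le_coe.2 (processionNormalized_mono fun i => ?_)
  rw [← finsum_add_distrib (hfin.2 i) (hεfin i)]
  exact finsum_le_finsum' (hfin'.2 i) (((hfin.2 i).union (hεfin i)).subset (Function.support_add _ _))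
    fun vQ => hε i vQ

/-- **THE WINDOW `−|log(Θ)| ≤ −|log(Θ)|♮ ≤ −|log(Θ)| + E`** (monotone volumes below, packet excesses above).
[cite: Mochizuki2012, IUTchIV Thm 1.10 proof Step (v) pp. 27–29] [cite: DupuyHilado2025, §4.10] -/
theorem hullGlued_negLogTheta_window (hmono : LogvolMono P) (hfin : P.ThetaFinite) (hfin' : P.hullGlued.ThetaFinite) :
    P.negLogTheta ≤ P.hullGlued.negLogTheta ∧
      P.hullGlued.negLogTheta ≤
        P.negLogTheta + ((processionNormalized fun i : Fin T.lstar => ∑ᶠ vQ : T.VQ, ε i vQ : ℝ) : WithTop ℝ) :=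
  ⟨negLogTheta_le_hullGlued_negLogTheta hmono hfin hfin', hullGlued_negLogTheta_le_add ε hεfin hε hfin hfin'⟩

/-- **The typed Statement FOR `P♮` read back on `P`: `−|log(q)| ≤ −|log(Θ)| + E`** — the converse of w5-d060's
transfer `P.Statement → P♮.Statement`, up to the explicit excess (`E = 0`, i.e. `hst` everywhere, recovers the
equivalence of p424693). Neither Statement is asserted. [claim: Mochizuki2012, status: disputed] -/
theorem negLogQ_le_negLogTheta_add_of_hullGlued_statement (hfin : P.ThetaFinite) (h' : P.hullGlued.Statement) :
    ((P.negLogQ : ℝ) : WithTop ℝ) ≤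
      P.negLogTheta + ((processionNormalized fun i : Fin T.lstar => ∑ᶠ vQ : T.VQ, ε i vQ : ℝ) : WithTop ℝ) := by
  have hfin' : P.hullGlued.ThetaFinite := by
    by_contra hf
    exact h'.1 (by unfold Setting.negLogTheta; rw [if_neg hf])
  have h2 := h'.2
  rw [P.hullGlued_negLogQ] at h2
  exact h2.trans (hullGlued_negLogTheta_le_add ε hεfin hε hfin hfin')

/-- Real-number form: `−|log(q)| ≤ processionNormalized(Σ μ^log(^{n,∘}𝒰)) + E`. [claim: Mochizuki2012, status: disputed] -/
theorem negLogQ_le_add_of_hullGlued_statement (hfin : P.ThetaFinite) (h' : P.hullGlued.Statement) :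
    P.negLogQ ≤
      (processionNormalized fun i : Fin T.lstar => ∑ᶠ vQ : T.VQ, (P.thetaLocal (labelSucc i) vQ).untopD 0) +
        processionNormalized fun i : Fin T.lstar => ∑ᶠ vQ : T.VQ, ε i vQ := by
  have h := negLogQ_le_negLogTheta_add_of_hullGlued_statement ε hεfin hε hfin h'
  rw [P.negLogTheta_eq_of_thetaFinite hfin, ← WithTop.coe_add] at h
  exact WithTop.coe_le_coe.1 h

end Excess

/-! ## 2b. The excess from packet data: containers on a finite exceptional set, stability elsewhere -/

section Cover

variable (E : Fin T.lstar → Set T.VQ) (hE : ∀ i, (E i).Finite)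
  (hst : ∀ (i : Fin T.lstar) (vQ : T.VQ), vQ ∉ E i → ∀ Φ ∈ indGroup S,
    Φ (labelSucc i) vQ '' P.thetaHull (labelSucc i) vQ = P.thetaHull (labelSucc i) vQ)
  (hHas : ∀ (i : Fin T.lstar) (vQ : T.VQ), ∀ H ∈ (P.frame (labelSucc i) vQ).Hul,
    (P.frame (labelSucc i) vQ).HasHull H)
  (H : ∀ (i : Fin T.lstar) (vQ : T.VQ), Set (S.L.Packet (labelSucc i) vQ))
  (hH : ∀ (i : Fin T.lstar) (vQ : T.VQ), vQ ∈ E i → H i vQ ∈ (P.frame (labelSucc i) vQ).Hul)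
  (hsubH : ∀ (i : Fin T.lstar) (vQ : T.VQ), vQ ∈ E i → P.hullGlued.thetaHull (labelSucc i) vQ ⊆ H i vQ)

include hst hHas hH hsubH

open scoped Classical in
/-- **Packet excesses from a cover**: `hst` off a set `E_i` and hull-set containers `H_{i,v_ℚ} ⊇ ^{n,∘}𝒰♮_{i+1,v_ℚ}`
on `E_i` give, at every label packet with both hulls defined,
`μ^log(^{n,∘}𝒰♮) ≤ μ^log(^{n,∘}𝒰) + ε_i(v_ℚ)` with `ε_i(v_ℚ) = μ^log(H_{i,v_ℚ}) − μ^log(^{n,∘}𝒰_{i+1,v_ℚ})` on `E_i` and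
`0` elsewhere (there the local Θ-volumes AGREE, p424693 `hullGlued_hullDefined_thetaLocal_of_stable`).
[cite: Mochizuki2012, IUTchIV Thm 1.10 proof Step (v) pp. 27–29] [cite: DupuyHilado2025, §4.10] -/
theorem hullGlued_thetaLocal_le_add_of_cover (hmono : LogvolMono P) (hfin : P.ThetaFinite)
    (hfin' : P.hullGlued.ThetaFinite) (i : Fin T.lstar) (vQ : T.VQ) :
    (P.hullGlued.thetaLocal (labelSucc i) vQ).untopD 0 ≤
      (P.thetaLocal (labelSucc i) vQ).untopD 0 +
        (if vQ ∈ E i then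
          (S.D P.n).logvol _ vQ (H i vQ) - (S.D P.n).logvol _ vQ (P.thetaHull (labelSucc i) vQ) else 0) := by
  have hdef : P.HullDefined (labelSucc i) vQ := by
    by_contra hd
    exact hfin.1 i vQ (by unfold Setting.thetaLocal; rw [if_neg hd])
  have hdef' : P.hullGlued.HullDefined (labelSucc i) vQ := by
    by_contra hd
    exact hfin'.1 i vQ (by unfold Setting.thetaLocal; rw [if_neg hd])
  by_cases hmem : vQ ∈ E i
  · rw [if_pos hmem]
    have hle := hullGlued_thetaLocal_le_logvol hmono i vQ (hH i vQ hmem) hdef' (hsubH i vQ hmem)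
    unfold Setting.thetaLocal at hle ⊢
    rw [if_pos hdef'] at hle
    rw [if_pos hdef', if_pos hdef, WithTop.untopD_coe, WithTop.untopD_coe]
    have hle' := WithTop.coe_le_coe.1 hle
    linarith
  · rw [if_neg hmem, add_zero, (P.hullGlued_hullDefined_thetaLocal_of_stable (hst i vQ hmem) (hHas i vQ) hdef).2]

include hE in
open scoped Classical in
/-- **`−|log(Θ)|♮ ≤ −|log(Θ)| + E` with `E` the procession-normalized sum, over the finite exceptional sets `E_i`, of
the container excesses `μ^log(H_{i,v_ℚ}) − μ^log(^{n,∘}𝒰_{i+1,v_ℚ})`** — and `−|log(Θ)| ≤ −|log(Θ)|♮`.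
[cite: Mochizuki2012, IUTchIV Thm 1.10 proof Step (v) pp. 27–29] [cite: DupuyHilado2025, §4.10] -/
theorem hullGlued_negLogTheta_le_add_of_cover (hmono : LogvolMono P) (hfin : P.ThetaFinite)
    (hfin' : P.hullGlued.ThetaFinite) :
    P.negLogTheta ≤ P.hullGlued.negLogTheta ∧
      P.hullGlued.negLogTheta ≤
        P.negLogTheta + ((processionNormalized fun i : Fin T.lstar => ∑ᶠ vQ : T.VQ,
          (if vQ ∈ E i then
            (S.D P.n).logvol _ vQ (H i vQ) - (S.D P.n).logvol _ vQ (P.thetaHull (labelSucc i) vQ) else 0) : ℝ) :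
          WithTop ℝ) := by
  refine hullGlued_negLogTheta_window _ (fun i => (hE i).subset fun vQ hvQ => ?_)
    (hullGlued_thetaLocal_le_add_of_cover E hst hHas H hH hsubH hmono hfin hfin') hmono hfin hfin'
  by_contra hmem
  exact hvQ (if_neg hmem)

include hE in
open scoped Classical in
/-- … hence **the typed Statement for `P♮` yields `−|log(q)| ≤ −|log(Θ)| + E` for `P`** with that explicit `E`.
Neither Statement is asserted. [claim: Mochizuki2012, status: disputed] -/
theorem negLogQ_le_negLogTheta_add_of_cover (hmono : LogvolMono P) (hfin : P.ThetaFinite)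
    (h' : P.hullGlued.Statement) :
    ((P.negLogQ : ℝ) : WithTop ℝ) ≤
      P.negLogTheta + ((processionNormalized fun i : Fin T.lstar => ∑ᶠ vQ : T.VQ,
        (if vQ ∈ E i then
          (S.D P.n).logvol _ vQ (H i vQ) - (S.D P.n).logvol _ vQ (P.thetaHull (labelSucc i) vQ) else 0) : ℝ) :
        WithTop ℝ) := by
  have hfin' : P.hullGlued.ThetaFinite := by
    by_contra hf
    exact h'.1 (by unfold Setting.negLogTheta; rw [if_neg hf])
  refine negLogQ_le_negLogTheta_add_of_hullGlued_statement _ (fun i => (hE i).subset fun vQ hvQ => ?_)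
    (hullGlued_thetaLocal_le_add_of_cover E hst hHas H hH hsubH hmono hfin hfin') hfin h'
  by_contra hmem
  exact hvQ (if_neg hmem)

end Cover

end Summit.ABC.IUTFork.Cor312Vol

end
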